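import Mathlib
import Summits.KontsevichZagierPeriods.KontsevichZagierPeriods.Theorems.SoloInformedKummerFixedPoint
import HarnessLib
import HarnessLib.Audit

/-!
# Kummer family V: the torsion packet of order two (s40)

For the Legendre family `Π(n | m) = ∫₀¹ dx /((1−nx²)√((1−x²)(1−mx²)))`, `m = k²`, the pole point
`u₀` (`sn²u₀ = 1/n`) has `4u₀ ∈ Λ` (the residue divisor `(P₊) − (P₋) = 2u₀` is `2`-torsion) at
exactly THREE real parameters `n < 1`:
* `n = 1 − k'` (`u₀ = K/2 + iK'`, hyperbolic band): `2k'·⟦Π⟧ = (1+k')·⟦K⟧` — COR XXVIII.4,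
  `soloInformed_ellipticPi_fixedPole` (the fixed point of the pole involution);
* `n = k` (`u₀ = K + iK'/2`, circular band): `4(1−k)·⟦Π⟧ = ⟦π⟧ + 2(1−k)·⟦K⟧` — THEOREM XXIV,
  `soloInformed_ellipticPi_torsion_pi` (one move);
* `n = −k` (`u₀ = iK'/2`, negative band) — THIS FILE:
  `4(1+k)·⟦Π(−k | k²)⟧ = ⟦π⟧ + 2(1+k)·⟦K⟧` in `P`,
  i.e. `Π(−k | k²) = K/2 + π/(4(1+k))`: the formula of THEOREM XXIV continued to `k ↦ −k`
  (`m = k²` is even in `k`).  In the period calculus it is a CHAIN: the pole involution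
  `n ↦ (m−n)/(1−n)` exchanges `k` and `−k` (THEOREM XXVIII(c), one move, KERNEL), rule (1b)
  splits `Q_k`, and THEOREM XXIV evaluates `⟦Π(k | k²)⟧`; the rest is point-class algebra in the
  commutative ring `P`.  With this file the whole order-two torsion packet `{1−k', k, −k}` of the
  Kummer family is settled by kernel theorems (THEOREM XXIX of the text at torsion order `2`).

References: M. Abramowitz – I. Stegun, Handbook of Mathematical Functions (1964), §17.7
(17.7.17, 17.7.22–23); D. F. Lawden, Elliptic Functions and Applications (1989), (3.8.34);
M. Kontsevich – D. Zagier, Periods (2001), §1.2; this work.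
-/

noncomputable section

open MeasureTheory Set Filter
open scoped Classical

open Literature.NumberTheory.Transcendental Literature.NumberTheory.Transcendental.KZ
open Literature.ModelTheory.ExponentialFields

namespace Summit.KontsevichZagierPeriods.KontsevichZagierPeriods.Theorems

/-! ### The negative 2-torsion fibre `n = −k` -/

/-- **COROLLARY XXIX.5 (the negative fibre of the order-two torsion packet, in `P`).** For real
algebraic `0 < k < 1` and representations `Π(−k | k²) = [(0,1), f/(1+kx²)]`, `K = [(0,1), f]`
(`f = ((1−x²)(1−k²x²))^{-1/2}`):
  `4·⟦[pt,1+k]⟧·⟦Π(−k | k²)⟧ = ⟦π⟧ + 2·⟦[pt,1+k]⟧·⟦K⟧`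
— the pole involution (THEOREM XXVIII(c), one move) carries `n = k` to `N = −k`, rule (1b)
splits `Q_k`, THEOREM XXIV evaluates `⟦Π(k | k²)⟧`. [this work] -/
theorem soloInformed_ellipticPi_negTorsion (k : ℝ) (hk : k ∈ Ioo (0:ℝ) 1)
    (hka : IsAlgebraic ℚ k) (PN K : IntegralRep 1)
    (hPNd : PN.domain = {x | x 0 ∈ Ioo (0:ℝ) 1})
    (hPNi : EqOn PN.integrand (fun x => (1 + k * x 0 ^ 2)⁻¹ *
      ((√(1 - x 0 ^ 2))⁻¹ * (√(1 - k ^ 2 * x 0 ^ 2))⁻¹)) PN.domain)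
    (hKd : K.domain = {x | x 0 ∈ Ioo (0:ℝ) 1})
    (hKi : EqOn K.integrand (fun x => (√(1 - x 0 ^ 2))⁻¹ * (√(1 - k ^ 2 * x 0 ^ 2))⁻¹)
      K.domain) :
    4 * (toFormalPeriod (of (IntegralRep.unit.constMul (1 + k) (isAlgebraic_one.add hka))) *
        toFormalPeriod (of PN)) =
      toFormalPeriod (of KZ.piRep) +
        2 * (toFormalPeriod (of (IntegralRep.unit.constMul (1 + k) (isAlgebraic_one.add hka))) *
          toFormalPeriod (of K)) := by
  obtain ⟨hk0, hk1⟩ := hk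
  have hk0' : k ≠ 0 := hk0.ne'
  have hm : k ^ 2 ∈ Ioo (0:ℝ) 1 := ⟨by positivity, by nlinarith⟩
  have hma : IsAlgebraic ℚ (k ^ 2) := hka.pow 2
  have h1k : IsAlgebraic ℚ (1 - k) := isAlgebraic_one.sub hka
  have h1k' : IsAlgebraic ℚ (1 + k) := isAlgebraic_one.add hka
  have h2k : IsAlgebraic ℚ (2 * (1 - k)) := (isAlgebraic_nat (R := ℚ) (A := ℝ) 2).mul h1k
  have h2k' : IsAlgebraic ℚ (2 * k) := (isAlgebraic_nat (R := ℚ) (A := ℝ) 2).mul hka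
  have hc1 : IsAlgebraic ℚ (k ^ 2 / k) := hma.mul hka.inv
  have hc2 : IsAlgebraic ℚ (1 - k ^ 2 / k) := isAlgebraic_one.sub hc1
  -- the circular fibre `Π(k | k²)` and THEOREM XXIV
  obtain ⟨P, hPd, hPi⟩ := soloInformed_exists_ellipticPi_rep k (k ^ 2) ⟨hk0, hk1⟩ hka hm hma
  have hX := soloInformed_ellipticPi_torsion_pi k ⟨hk0, hk1⟩ hka P K hPd (fun x _ => hPi x) hKd
    hKi h2k h1k
  -- the pole involution `k ↦ N = (k² − k)/(1 − k) = −k` (THEOREM XXVIII(c) + rule (1b))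
  have hN : (k ^ 2 - k) / (1 - k) = -k := by
    rw [div_eq_iff (by linarith : (1:ℝ) - k ≠ 0)]
    ring
  have hL := soloInformed_kummer_poleInvolution_law (k ^ 2) k hm hma hk1 hk0' hka hc1 hc2 PN K P
    hPNd (fun x hx => by simp only [hPNi hx, hN, neg_mul, sub_neg_eq_add]) hKd hKi hPd
    (fun x _ => hPi x)
  rw [soloInformed_pointRep_congr hc1 hka (by rw [sq, mul_div_cancel_right₀ _ hk0']),
    soloInformed_pointRep_congr hc2 h1k (by rw [sq, mul_div_cancel_right₀ _ hk0']),
    ← soloInformed_pointRep_mul_eq (1 - k) (1 + k) (1 - k ^ 2) h1k h1k'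
      (isAlgebraic_one.sub hma) (by ring), mul_assoc] at hL
  have h2 := soloInformed_pointRep_cancel (1 - k) h1k (by linarith) hL
  -- point-class arithmetic: `⟦1−k⟧·2 = ⟦2(1−k)⟧`, `⟦k⟧·2 = ⟦2k⟧`, `⟦1−k⟧ + ⟦2k⟧ = ⟦1+k⟧`
  have hT := soloInformed_pointRep_mul_natCast_eq (1 - k) (2 * (1 - k)) 2 h1k h2k
    (by push_cast; ring)
  have hD := soloInformed_pointRep_mul_natCast_eq k (2 * k) 2 hka h2k' (by push_cast; ring)
  simp only [Nat.cast_ofNat] at hT hD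
  have h3k : IsAlgebraic ℚ (1 - k + 2 * k) := by
    rw [show (1:ℝ) - k + 2 * k = 1 + k by ring]; exact h1k'
  have hadd := soloInformed_pointRep_add (1 - k) (2 * k) h1k h2k' h3k
  rw [soloInformed_pointRep_congr h3k h1k' (by ring)] at hadd
  linear_combination 4 * h2 + hX + (2 * toFormalPeriod (of P)) * hT +
    (2 * toFormalPeriod (of K)) * hadd + (2 * toFormalPeriod (of K)) * hD

/-- COROLLARY XXIX.5 in values: `4(1+k)·Π(−k | k²) = π + 2(1+k)·K(k)`, i.e.
`Π(−k | k²) = K/2 + π/(4(1+k))` — THEOREM XXIV (`Π(k | k²) = K/2 + π/(4(1−k))`) continued to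
`k ↦ −k`. [AS64, 17.7.17 with 17.7.22; this work] -/
theorem soloInformed_ellipticPi_negTorsion_value (k : ℝ) (hk : k ∈ Ioo (0:ℝ) 1)
    (hka : IsAlgebraic ℚ k) (PN K : IntegralRep 1)
    (hPNd : PN.domain = {x | x 0 ∈ Ioo (0:ℝ) 1})
    (hPNi : EqOn PN.integrand (fun x => (1 + k * x 0 ^ 2)⁻¹ *
      ((√(1 - x 0 ^ 2))⁻¹ * (√(1 - k ^ 2 * x 0 ^ 2))⁻¹)) PN.domain)
    (hKd : K.domain = {x | x 0 ∈ Ioo (0:ℝ) 1})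
    (hKi : EqOn K.integrand (fun x => (√(1 - x 0 ^ 2))⁻¹ * (√(1 - k ^ 2 * x 0 ^ 2))⁻¹)
      K.domain) :
    4 * ((1 + k) * PN.value) = Real.pi + 2 * ((1 + k) * K.value) := by
  have h := congrArg evalP (soloInformed_ellipticPi_negTorsion k hk hka PN K hPNd hPNi hKd hKi)
  simpa only [map_mul, map_add, map_ofNat, evalP_toFormalPeriod_of, IntegralRep.value_constMul,
    IntegralRep.value_unit, mul_one, piRep_value] using h

end Summit.KontsevichZagierPeriods.KontsevichZagierPeriods.Theorems

end
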